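import Summits.Ventures.HSemireg.UntwistCocycleTwistSigmaAll
import Summits.Ventures.HSemireg.HomComplexSigmaSingle
import HarnessLib

/-!
# Venture HSemireg — route R1.0, untwisted reading: ALL rows of `hσ` on the K2 chain's COMPLEX carriers for a single
# sheaf (gs-g4; corollary of `UntwistCocycleTwistSigmaAll.lean` and the anchor `HomComplexSigmaSingle.lean`)

HONEST FRAMING. A two-line corollary joining two landed results; real carriers (`HomComplex.IsISemiregularC` = the K2
chain's predicate on strictly perfect complexes, here for the one-term complex `E₀[0]`). Nothing about any variety;
no gerbe; nothing here says HC, HC_CM or HC_AV is proved.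

* `isISemiregularC_single₀_iff_twist_of_locallyFree` — **`IsISemiregularC(E₀[0], I) ↔ IsISemiregularC((E₀⟨c⟩)[0], I)`**
  for every cocycle `c`, every finite locally free `E₀`, every LOWER set `I` of form degrees, when the `Ωʲ_{X/S}` are
  finite locally free: the anchor `isISemiregularC_single₀_iff` (`IsISemiregularC(E₀[0], I) ↔ IsISemiregular(E₀, I)`)
  on both sides and `isISemiregular_iff_twist_of_locallyFree` (all rows of `hσ` discharged). The STEP-0 object is a
  genuine two-term complex: this is a consistency anchor only (the complex-carrier Leibniz rule for `HomComplex.sigmaC`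
  is NOT claimed).

## References

* R.-O. Buchweitz, H. Flenner, Compositio Math. 137 (2003), §5 (`I`-semiregular). [BuchweitzFlenner2003]
-/

noncomputable section

open CategoryTheory AlgebraicGeometry

namespace Summit.Ventures.HSemireg

namespace CocycleTwist

open Literature.AlgebraicGeometry.Modules Literature.AlgebraicGeometry.Motives Literature.AlgebraicGeometry.HodgeTheory
  HomComplex

universe u

variable {S : Type u} [CommRing S] (X : Over (Spec (CommRingCat.of S))) [HasDerivedCategory.{u + 1} X.left.Modules]
  (c : UnitCocycle X.left) (E₀ : X.left.Modules) (hE₀ : IsFiniteLocallyFree E₀)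
  (hΩ : ∀ j, IsFiniteLocallyFree (hodgeSheaf X j))
  (hK : ∀ p, IsFiniteLocallyFree ((single₀ X.left E₀).X p))
  (hK' : ∀ p, IsFiniteLocallyFree ((single₀ X.left (twist c E₀)).X p))

include hE₀ hΩ in
/-- **`I`-semiregularity of the one-term complexes `E₀[0]` and `(E₀ ⊗ M)[0]` agree for every LOWER set `I`** (the K2
chain's predicate `HomComplex.IsISemiregularC`, window `[0, 0]`), for every cocycle `c`, when the `Ωʲ_{X/S}` are finite
locally free: all rows of the Leibniz re-expansion on real carriers, read through the single-sheaf anchor.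
[cite: BuchweitzFlenner2003, §5 (I-semiregular)] -/
theorem isISemiregularC_single₀_iff_twist_of_locallyFree {I : Set ℕ} (hI : IsLowerSet I) :
    IsISemiregularC X (single₀ X.left E₀) 0 0 hK I ↔ IsISemiregularC X (single₀ X.left (twist c E₀)) 0 0 hK' I := by
  rw [isISemiregularC_single₀_iff X E₀ hE₀ hK,
    isISemiregularC_single₀_iff X (twist c E₀) (isFiniteLocallyFree_twist c hE₀) hK']
  exact isISemiregular_iff_twist_of_locallyFree c hE₀ hΩ hI

include hE₀ hΩ in
/-- **FULL semiregularity of `E₀[0]` iff of `(E₀ ⊗ M)[0]`** on the complex carriers (`I = univ`).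
[cite: BuchweitzFlenner2003, Def. 4.1 and §5] -/
theorem isISemiregularC_single₀_univ_iff_twist_of_locallyFree :
    IsISemiregularC X (single₀ X.left E₀) 0 0 hK Set.univ ↔
      IsISemiregularC X (single₀ X.left (twist c E₀)) 0 0 hK' Set.univ :=
  isISemiregularC_single₀_iff_twist_of_locallyFree X c E₀ hE₀ hΩ hK hK' isLowerSet_univ

end CocycleTwist

end Summit.Ventures.HSemireg

end
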